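import Summits.BirchSwinnertonDyer.Rank1Residual.ManinAdditive.CMTwinStevensMinimalMembersCor
import HarnessLib

/-!
# CM root `Γ₁(N)`-laws beyond `ℚ(i)` — THEOREM 45 transferred to `K = ℚ(√−2)` and to `K = ℚ(√−3)` at the prime `2`
# (cell `bsd-f2-manin`, planner `es` g32, MEMO-es §47; FILE A′ = this file, lands after `…CMTwinStevensMinimalMembersCor`; T-es-52)

TYPER NOTE (typer g20, T-es-52).  SOURCE = HOME/es/g32/BeyondQi-es-g32.lean sha16 de7f41b8f5aee3ca (171 l.; es: the identical §7 text
self-contained in Sketch-es-g32.lean 35daa66879e2d61d l.422–575 is farm rc 0 · 0 err · 0 warn · 0 s∗rry; FILE A′ itself answered rc 75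
`remote:stale:1338` at es's check because its import `…CMTwinStevensMinimalMembersCor` (p729422) had no farm olean yet; typer: own farm check of
THIS text rc 0 · 0 warnings once the olean existed) VERBATIM except this note and ONE `open` delta: es's standalone file opens only
`Complex Polynomial WeierstrassCurve Literature.NumberTheory.EllipticCurves`, while the §7 text was checked inside Sketch-es-g32 whose l.45–48 also open
`Literature.NumberTheory.EllipticCurves.ModularForms`, `…KatoCurve.CMOptimal`, `…KatoCurve.CMOptimal.TwinLattice` (as do the landed FILE A modules) — without
them `IsNewformOf`, `IsNeronLatticeOf`, `periodLatticeGamma1`, `Gamma1ParametrizationData`, … do not resolve (farm: 29 errors); the typer restored the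
Sketch's four-namespace `open` (context of record; no statement text changed).  Continues ns `…ManinAdditive.KatoCurve.CMTwinMinimal` (FILE A =
`CMTwinStevensMinimalMembers` p729412 + `…Cor` p729422, T-es-51).  `@[conjecture]` (es's own tags) on the cell rows **E-es-154
`CMGammaOneRootLawTwoLocalJ8000`** (root Γ₁(N)-law, 2-local, on the ℚ(√−2)-CM slice j = 8000) and **E-es-155 `CMGammaOneRootLawTwoLocalJ0`** (root
Γ₁(N)-law at 2 on every ℚ(√−3)-CM curve c₄ = 0 with 4 ∣ N) — es files both as THEOREM 47 = THEOREM 45 (MEMO-es §45, ref1 §R163/§R167 SOUND)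
transferred to K = ℚ(√−2) resp. to 𝔭 = (2) inert in ℚ(√−3), PAPER proof MEMO-es §47, audit R-es-73 PENDING at landing time ⇒ obligation nodes until
kernel-checked.  PROVED here (es): COR 47 — `not_two_dvd_maninConstant₁_on_cmClass_sqrtNegTwo_of_rootLaw` / `not_two_dvd_maninConstant_on_cmClass_sqrtNegTwo_of_rootLaw`
(Stevens' 2 ∤ c₁ and C2's 2 ∤ c₀ on the ℚ(√−2) slice: no SHAPE, no Faltings), `not_two_dvd_maninConstant₁/maninConstant_on_cmClass_three_of_rootLawAtTwo_of_classMembers`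
(every ℚ(√−3)-CM class with 4 ∣ N, via THM 46₃ `cmTwinStevensMinimalThree_of_classMembers` + COR 46 `exists_primitive_witness`) and the lattice-free
forms `…_noLattice` (binders (LV, hLV) discharged by `ModularForms.exists_isNeronLatticeOf_holds`, ref1 §R173-ADDENDUM pattern).  BC5 (es): census
GAMMA-SLICE-v1 (38 classes N = 256·d² for j = 8000; 1137 classes 4 ∣ N for j = 0, N < 5·10⁵), engine-C ports ENGINEC-R2-v1 / ENGINEC-P2-w-v1; data ask
D-es-g32-1 open.  Typer checks: decl names fresh in the tree; `[cite: CremonaAlgorithms1997, Table 1]` key present; imports `…CMTwinStevensMinimalMembersCor`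
+ HarnessLib only (route-independent ManinAdditive cone); no instances, no notation.  PARTITION 0 · beyond-print theorem: no (paper candidate) ·
bears_on stmt-BirchSwinnertonDyer-22967 (C2 `KatoNeronIntegralTwoGamma1OptimalOnBlindCore` on the CM classes beyond ℚ(i); FILE B′ = Theorems-side,
p-seats) · BSD is not proved by this; E-es-154/155 and C2 OPEN.

Contents: two conjecture nodes (E-es-154 `CMGammaOneRootLawTwoLocalJ8000`, E-es-155 `CMGammaOneRootLawTwoLocalJ0`) and COR 47: Stevens' `2 ∤ c₁` and C2's
`2 ∤ c₀` on the `ℚ(√−2)`-CM slice (no SHAPE, no Faltings) and on EVERY `ℚ(√−3)`-CM class with `4 ∣ N`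
(via THM 46₃ `cmTwinStevensMinimalThree_of_classMembers`, whose lattice inclusion is prime-independent), plus
the lattice-free forms (binders `(LV, hLV)` discharged by `exists_isNeronLatticeOf_holds`, ref1 §R173 ADDENDUM pattern).
Status of the laws: E-es-154 / E-es-155 = THEOREM 47 := THEOREM 45 + §45.D (MEMO-es §45, REF1 §R163/R167) transferred to
`K = ℚ(√−2)` resp. `K = ℚ(√−3)` at `𝔭 = (2)` — PAPER (audit ask R-es-73); kernel status: conjecture nodes.
PARTITION 0 · beyond-print theorem: no · bears_on stmt-BirchSwinnertonDyer-22967 · BSD is not proved by this.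
-/

namespace Summit.BirchSwinnertonDyer.Rank1Residual.ManinAdditive.KatoCurve.CMTwinMinimal

open Complex Polynomial WeierstrassCurve Literature.NumberTheory.EllipticCurves
  Literature.NumberTheory.EllipticCurves.ModularForms
  Summit.BirchSwinnertonDyer.Rank1Residual.ManinAdditive.KatoCurve.CMOptimal
  Summit.BirchSwinnertonDyer.Rank1Residual.ManinAdditive.KatoCurve.CMOptimal.TwinLattice

/-! ## §7 Beyond `ℚ(i)`: the `ℚ(√−2)` slice (`j = 8000`) and the `ℚ(√−3)` classes AT THE PRIME 2

THEOREM 45 (MEMO-es §45, paper) is field-generic: its five steps use only `h_K = 1`, CM by `O_K`, `𝔭 ∣ 𝔣_ψ` with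
`𝔭 ∣ p` ramified OR inert (supersingular reduction), the ray class field `R_k = K(𝔭^k)` (totally ramified at `𝔭`,
degree `h_k`, different exponent `d_k`) and Serre's trace lemma.  Transferred (MEMO-es §47):
* `K = ℚ(√−2)`, `𝔭 = (√−2)`, `j = 8000`, `2⁸ ∥ N`, `k = 5`, `h₅ = 8`, `d₅ = 30`, `ν ∈ {3/4, 5/4}` ⟹ `δ ∈ {0, −1}`:
  the ROOT law holds at BOTH members of every class (class = `{V, V ⊗ χ₋₂}`), law E-es-154 below;
* `K = ℚ(√−3)`, `𝔭 = (2)` inert, `c₄ = 0`, `k₂ = v₂(N)/2`, `(h, d) = (1, 0), (2, 2), (8, 20)` for `k₂ = 1, 2, 3`,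
  `j_k = ⌊h_k ν⌋ + 1`, `δ = k₂ − ⌊(j_k + d_k)/h_k⌋`: `δ = 0` on the strata `4 ∥ N`; `64 ∥ N`; `16 ∥ N ∧ 2⁶ ∣ c₆`;
  on the residual stratum `16 ∥ N ∧ v₂(c₆) = 5` (e.g. `144a`; `δ = 1` from the different alone) §45.D transferred
  (free `μ₆`-orbit factor `w = 6`, `v₂(6) = 1`; `υ = 1/3`, `τ = 1/12`, granularity `½ℤ`) supplies the missing unit:
  THEOREM 47 = the root law on EVERY `ℚ(√−3)`-CM curve with `4 ∣ N`, law E-es-155 below. -/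

section BeyondQi

open CongruenceSubgroup
open scoped MatrixGroups ModularForm

variable {N : ℕ} [NeZero N]

/-- **E-es-154 — root `Γ₁(N)`-law on the `ℚ(√−2)`-CM slice, `2`-local** (THEOREM 45 transferred to `K = ℚ(√−2)`:
`k = 5`, `h₅ = 8`, `d₅ = 30`; both members of each class satisfy it, `δ = 0` resp. `−1`).
[B] es g32 MEMO-es §47; census GAMMA-SLICE-v1 (38 classes `N < 5·10⁵`, all `N = 256·d²`). -/
@[conjecture]
def CMGammaOneRootLawTwoLocalJ8000 : Prop :=
  ∀ (V : WeierstrassCurve ℚ) [V.IsElliptic] [V.IsGloballyMinimal] {N : ℕ} [NeZero N]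
    (f : CuspForm (Gamma0 N) 2) (L : PeriodPair),
    V.j = 8000 → IsNewformOf V f → IsNeronLatticeOf (V.baseChange ℂ) L →
    ∀ z ∈ periodLatticeGamma1 f, ∃ s : ℤ, ¬ (2 : ℤ) ∣ s ∧ (s : ℂ) * z ∈ L.lattice

/-- **E-es-155 — root `Γ₁(N)`-law at the prime `2` on EVERY `ℚ(√−3)`-CM curve (`c₄ = 0`) with `4 ∣ N`**
(`v₂(N) = 2k₂`, `k₂ ∈ {1, 2, 3}` automatically).  THEOREM 47 (MEMO-es §47, paper): THEOREM 45 transferred to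
`𝔭 = (2)` inert (`(h, d) = (1, 0), (2, 2), (8, 20)` for `k₂ = 1, 2, 3`) gives `δ = 0` on `4 ∥ N`, `64 ∥ N` and
`16 ∥ N ∧ 2⁶ ∣ c₆`; the residual stratum `16 ∥ N ∧ v₂(c₆) = 5` (e.g. `144a`; `υ = 1/3`, `τ = 1/12`, granularity `½ℤ`)
falls to §45.D transferred — the free `μ₆`-orbit factor `w = 6`, `v₂(6) = 1`, lifts the two binding monomial sums
`S′₁₀, S′₀₁` and the class value clears `v > 1/2`, hence `v ≥ 1` (engine-C: `v_{𝔓_R}(G_V(1)) = 2 = the bound` in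
11/13 instances, `v₂(D/Ω′) ≥ 0` in 18/18, ENGINEC-P2-w-v1).
[B] es g32 MEMO-es §47; census GAMMA-SLICE-v1 (1137 classes `N < 5·10⁵` with `4 ∣ N`). -/
@[conjecture]
def CMGammaOneRootLawTwoLocalJ0 : Prop :=
  ∀ (V : WeierstrassCurve ℚ) [V.IsElliptic] [V.IsGloballyMinimal] {N : ℕ} [NeZero N]
    (f : CuspForm (Gamma0 N) 2) (L : PeriodPair),
    V.c₄ = 0 → 2 ^ 2 ∣ N → IsNewformOf V f → IsNeronLatticeOf (V.baseChange ℂ) L →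
    ∀ z ∈ periodLatticeGamma1 f, ∃ s : ℤ, ¬ (2 : ℤ) ∣ s ∧ (s : ℂ) * z ∈ L.lattice

/-- **COR 47.S (√−2) — the `2`-part of Stevens' `c₁ = ±1` on the whole `ℚ(√−2)`-CM slice** (every member has
`j = 8000`, so the law applies at the optimal curve itself: no SHAPE, no Faltings). -/
theorem not_two_dvd_maninConstant₁_on_cmClass_sqrtNegTwo_of_rootLaw (h : CMGammaOneRootLawTwoLocalJ8000)
    (W : WeierstrassCurve ℚ) [W.IsElliptic] [W.IsGloballyMinimal] (D : Gamma1ParametrizationData W N)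
    (hopt : D.IsOptimal) (hj : W.j = 8000) : ¬ (2 : ℤ) ∣ D.maninConstant :=
  not_dvd_maninConstant₁_of_rootLaw_of_witness D hopt (h W D.f D.L hj D.isNewformOf D.isNeronLattice)
    (exists_primitive_witness D.L 2)

/-- **COR 47.R (√−2) — C2 for `X₀(N)`-data on the `ℚ(√−2)`-CM classes with a second traceless prime `q`**
(`N = 256·d²`, `q ∣ d`; the residue `d = ±1` is `{256a, 256d}`, `c₀ = 1` by [cite: CremonaAlgorithms1997, Table 1]). -/
theorem not_two_dvd_maninConstant_on_cmClass_sqrtNegTwo_of_rootLaw (h : CMGammaOneRootLawTwoLocalJ8000)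
    (W : WeierstrassCurve ℚ) [W.IsElliptic] [W.IsGloballyMinimal] (D : ModularParametrizationData W N)
    (hD : ∀ z ∈ D.L.lattice, ∃ w ∈ periodLattice D.f, z = D.c * w) (hj : W.j = 8000)
    {q : ℕ} (hq : q.Prime) (hq2 : q ≠ 2) (h4 : 2 ^ 2 ∣ N) (hqN : q ^ 2 ∣ N) :
    ¬ (2 : ℤ) ∣ D.maninConstant := by
  have hfW : IsNewformOf W D.f := D.isNewformOf
  have heq := ModularForms.gamma1LatticeEqOfTwoTracelessPrimes_holds N D.f hfW.1 2 q Nat.prime_two hq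
    (Ne.symm hq2) ((dvd_pow_self 2 two_ne_zero).trans h4) ((dvd_pow_self q two_ne_zero).trans hqN)
    (hfW.1.cuspCoeff_eq_zero_of_sq_dvd Nat.prime_two h4) (hfW.1.cuspCoeff_eq_zero_of_sq_dvd hq hqN)
  obtain ⟨z, hz, hzM⟩ := exists_primitive_witness D.L 2
  refine not_dvd_maninConstant_of_saturated_mem_of_witness D hD Int.prime_two D.L.lattice
    (fun γ => h W D.f D.L hj hfW D.isNeronLattice _ ?_) ⟨z, hz, fun s hs m hm => ?_⟩
  · rw [heq]; unfold periodLattice; exact AddSubgroup.subset_closure ⟨γ, rfl⟩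
  · exact_mod_cast hzM s hs m hm

/-- **COR 47.S (√−3 at 2) — the `2`-part of Stevens' `c₁ = ±1` for the `X₁(N)`-optimal curve of every `ℚ(√−3)`-CM
class with `4 ∣ N`** (`V` = the twist-reduced root, `c₄(V) = 0`): E-es-155 at the root + THM 46₃
(`Λ(V) ⊆ Λ(W)` for every member, prime-independent) + optimality + Faltings. -/
theorem not_two_dvd_maninConstant₁_on_cmClass_three_of_rootLawAtTwo_of_classMembers
    (h : CMGammaOneRootLawTwoLocalJ0) (hcl : CMClassMembersThree) (hL : LFunction_eq_of_isIsogenous)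
    (W : WeierstrassCurve ℚ) [W.IsElliptic] [W.IsGloballyMinimal] (D : Gamma1ParametrizationData W N)
    (hopt : D.IsOptimal)
    (V : WeierstrassCurve ℚ) [V.IsElliptic] [V.IsGloballyMinimal] (LV : PeriodPair) (h4 : V.c₄ = 0)
    (hN : 2 ^ 2 ∣ N)
    (hiso : WeierstrassCurve.IsIsogenous V W) (hLV : IsNeronLatticeOf (V.baseChange ℂ) LV)
    (hred : ∀ (W' : WeierstrassCurve ℚ) [W'.IsElliptic] [W'.IsGloballyMinimal],
        W'.j = 0 → WeierstrassCurve.IsIsogenous V W' → (W'.c₆ = V.c₆ ∨ W'.c₆ = -27 * V.c₆)) :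
    ¬ (2 : ℤ) ∣ D.maninConstant := by
  have hjV : V.j = 0 := by simp [WeierstrassCurve.j, h4]
  have hfV : IsNewformOf V D.f := isNewformOf_of_isIsogenous hL D.isNewformOf hiso
  have hle : LV.lattice ≤ D.L.lattice :=
    cmTwinStevensMinimalThree_of_classMembers hcl V W LV D.L hjV hiso hLV D.isNeronLattice hred
  refine not_dvd_maninConstant₁_of_rootLaw_of_witness D hopt (fun w hw => ?_) (exists_primitive_witness D.L 2)
  obtain ⟨s, hs, hsw⟩ := h V D.f LV h4 hN hfV hLV w hw
  exact ⟨s, hs, hle hsw⟩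

/-- **COR 47.R (√−3 at 2) — C2 for `X₀(N)`-data on the same classes** (second traceless prime `q = 3`: `9 ∣ N` on
every `ℚ(√−3)`-CM class). -/
theorem not_two_dvd_maninConstant_on_cmClass_three_of_rootLawAtTwo_of_classMembers
    (h : CMGammaOneRootLawTwoLocalJ0) (hcl : CMClassMembersThree) (hL : LFunction_eq_of_isIsogenous)
    (W : WeierstrassCurve ℚ) [W.IsElliptic] [W.IsGloballyMinimal] (D : ModularParametrizationData W N)
    (hD : ∀ z ∈ D.L.lattice, ∃ w ∈ periodLattice D.f, z = D.c * w)
    (V : WeierstrassCurve ℚ) [V.IsElliptic] [V.IsGloballyMinimal] (LV : PeriodPair) (h4 : V.c₄ = 0)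
    (hN : 2 ^ 2 ∣ N) (h9 : 3 ^ 2 ∣ N)
    (hiso : WeierstrassCurve.IsIsogenous V W) (hLV : IsNeronLatticeOf (V.baseChange ℂ) LV)
    (hred : ∀ (W' : WeierstrassCurve ℚ) [W'.IsElliptic] [W'.IsGloballyMinimal],
        W'.j = 0 → WeierstrassCurve.IsIsogenous V W' → (W'.c₆ = V.c₆ ∨ W'.c₆ = -27 * V.c₆)) :
    ¬ (2 : ℤ) ∣ D.maninConstant := by
  have hjV : V.j = 0 := by simp [WeierstrassCurve.j, h4]
  have hfV : IsNewformOf V D.f := isNewformOf_of_isIsogenous hL D.isNewformOf hiso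
  have hle : LV.lattice ≤ D.L.lattice :=
    cmTwinStevensMinimalThree_of_classMembers hcl V W LV D.L hjV hiso hLV D.isNeronLattice hred
  have heq := ModularForms.gamma1LatticeEqOfTwoTracelessPrimes_holds N D.f hfV.1 2 3 Nat.prime_two Nat.prime_three
    (by decide) ((dvd_pow_self 2 two_ne_zero).trans hN) ((dvd_pow_self 3 two_ne_zero).trans h9)
    (hfV.1.cuspCoeff_eq_zero_of_sq_dvd Nat.prime_two hN) (hfV.1.cuspCoeff_eq_zero_of_sq_dvd Nat.prime_three h9)
  obtain ⟨z, hz, hzM⟩ := exists_primitive_witness LV 2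
  refine not_dvd_maninConstant_of_saturated_mem_of_witness D hD Int.prime_two LV.lattice
    (fun γ => h V D.f LV h4 hN hfV hLV _ ?_) ⟨z, hle hz, fun s hs m hm => ?_⟩
  · rw [heq]; unfold periodLattice; exact AddSubgroup.subset_closure ⟨γ, rfl⟩
  · exact_mod_cast hzM s hs m hm


/-- COR 47.S (√−3 at 2), lattice-free form: the binders `(LV, hLV)` of
`not_two_dvd_maninConstant₁_on_cmClass_three_of_rootLawAtTwo_of_classMembers` discharged by
`exists_isNeronLatticeOf_holds` (ref1 §R173 ADDENDUM pattern). -/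
theorem not_two_dvd_maninConstant₁_on_cmClass_three_of_rootLawAtTwo_noLattice
    (h : CMGammaOneRootLawTwoLocalJ0) (hcl : CMClassMembersThree) (hL : LFunction_eq_of_isIsogenous)
    (W : WeierstrassCurve ℚ) [W.IsElliptic] [W.IsGloballyMinimal] (D : Gamma1ParametrizationData W N)
    (hopt : D.IsOptimal)
    (V : WeierstrassCurve ℚ) [V.IsElliptic] [V.IsGloballyMinimal] (h4 : V.c₄ = 0) (hN : 2 ^ 2 ∣ N)
    (hiso : WeierstrassCurve.IsIsogenous V W)
    (hred : ∀ (W' : WeierstrassCurve ℚ) [W'.IsElliptic] [W'.IsGloballyMinimal],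
        W'.j = 0 → WeierstrassCurve.IsIsogenous V W' → (W'.c₆ = V.c₆ ∨ W'.c₆ = -27 * V.c₆)) :
    ¬ (2 : ℤ) ∣ D.maninConstant := by
  obtain ⟨LV, hLV⟩ := ModularForms.exists_isNeronLatticeOf_holds (V.baseChange ℂ)
  exact not_two_dvd_maninConstant₁_on_cmClass_three_of_rootLawAtTwo_of_classMembers h hcl hL W D hopt V LV h4 hN
    hiso hLV hred

/-- COR 47.R (√−3 at 2), lattice-free form. -/
theorem not_two_dvd_maninConstant_on_cmClass_three_of_rootLawAtTwo_noLattice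
    (h : CMGammaOneRootLawTwoLocalJ0) (hcl : CMClassMembersThree) (hL : LFunction_eq_of_isIsogenous)
    (W : WeierstrassCurve ℚ) [W.IsElliptic] [W.IsGloballyMinimal] (D : ModularParametrizationData W N)
    (hD : ∀ z ∈ D.L.lattice, ∃ w ∈ periodLattice D.f, z = D.c * w)
    (V : WeierstrassCurve ℚ) [V.IsElliptic] [V.IsGloballyMinimal] (h4 : V.c₄ = 0) (hN : 2 ^ 2 ∣ N)
    (h9 : 3 ^ 2 ∣ N)
    (hiso : WeierstrassCurve.IsIsogenous V W)
    (hred : ∀ (W' : WeierstrassCurve ℚ) [W'.IsElliptic] [W'.IsGloballyMinimal],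
        W'.j = 0 → WeierstrassCurve.IsIsogenous V W' → (W'.c₆ = V.c₆ ∨ W'.c₆ = -27 * V.c₆)) :
    ¬ (2 : ℤ) ∣ D.maninConstant := by
  obtain ⟨LV, hLV⟩ := ModularForms.exists_isNeronLatticeOf_holds (V.baseChange ℂ)
  exact not_two_dvd_maninConstant_on_cmClass_three_of_rootLawAtTwo_of_classMembers h hcl hL W D hD V LV h4 hN h9
    hiso hLV hred

end BeyondQi

end Summit.BirchSwinnertonDyer.Rank1Residual.ManinAdditive.KatoCurve.CMTwinMinimal
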